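import Mathlib.CategoryTheory.Galois.Decomposition
import Literature.AnabelianGeometry.SemiGraphs.GaloisCountableGraphs
import Literature.AnabelianGeometry.Anabelioids.TerminalCoproductComponents
import HarnessLib

/-!
# Anabelioids: connected components of an object ↔ orbits of `π₁` on its fibre

Mochizuki, *Semi-graphs of anabelioids*, Publ. RIMS **42** (2006), §2 Def. 2.2 (i) p. 23: the
vertices / edges of the finite étale covering `𝒢'` attached to an object `G' = {S_v, T_e}` of
`B(𝒢)` are the connected components of the anabelioids `S_v`, `T_e` (tree: `π₀Obj`), and
Remark 2.2.1 p. 24 reads them as `Π_v`-orbits ("the stabilizers in `Π_𝒢`")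
[cite: MochizukiSemiAnbd2006, Def. 2.2(i) p.23].  [SGA1, Exp. V §4–5]: for a fibre functor `F`,
the connected components of `X` correspond to the orbits of `Aut F` on `F(X)`.

PROOF-ONLY (abc-iut L3 row `L3:FiniteEtaleLocalDictionary`, part (d) step 2 (i), L6-t17):

* `range_map_arrow_eq_orbit` — the fibre-image of a connected subobject `P ↪ X` is the `Aut F`-orbit
  of any of its points;
* `exists_component_mem_range` — every point of `F(X)` lies in the fibre-image of some connected
  component;
* `component_eq_of_mem_range` — which is unique.
-/

namespace Literature.AnabelianGeometry.Anabelioids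

open CategoryTheory CategoryTheory.Limits CategoryTheory.Functor CategoryTheory.PreGaloisCategory
  Literature.AnabelianGeometry.SemiGraphs

universe u₁ u₂ w

variable {C : Type u₁} [Category.{u₂} C] [GaloisCategory C] (F : C ⥤ FintypeCat.{w}) [FiberFunctor F]

/-- **Components are orbits.** The fibre-image `F(P) ↪ F(X)` of a connected subobject `P` of `X`
is the `Aut F`-orbit of any of its points (it is `Aut F`-stable by naturality, and `Aut F` acts
transitively on the fibre of the connected `P`). [cite: MochizukiSemiAnbd2006, Def. 2.2(i) p.23] -/
theorem range_map_arrow_eq_orbit {X : C} (P : π₀Obj X) {x : F.obj X}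
    (hx : x ∈ Set.range (F.map P.1.arrow)) :
    Set.range (F.map P.1.arrow) = MulAction.orbit (Aut F) x := by
  haveI : IsConnected (P.1 : C) := P.2
  obtain ⟨p₀, rfl⟩ := hx
  ext y
  constructor
  · rintro ⟨p, rfl⟩
    obtain ⟨σ, hσ⟩ := MulAction.exists_smul_eq (Aut F) p₀ p
    refine ⟨σ, ?_⟩
    show σ • F.map P.1.arrow p₀ = F.map P.1.arrow p
    rw [mulAction_def, ← hσ, mulAction_def]
    have h := ConcreteCategory.congr_hom (σ.hom.naturality P.1.arrow) p₀
    simp only [FintypeCat.comp_apply] at h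
    exact h
  · rintro ⟨σ, rfl⟩
    refine ⟨σ • p₀, ?_⟩
    show F.map P.1.arrow (σ • p₀) = σ • F.map P.1.arrow p₀
    rw [mulAction_def, mulAction_def]
    have h := ConcreteCategory.congr_hom (σ.hom.naturality P.1.arrow) p₀
    simp only [FintypeCat.comp_apply] at h
    exact h.symm

omit [FiberFunctor F] in
/-- Every point of the fibre `F(X)` lies in the fibre-image of some connected component of `X`
(decomposition into connected components). [cite: MochizukiSemiAnbd2006, Def. 2.2(i) p.23] -/
theorem exists_component_mem_range [FiberFunctor F] {X : C} (x : F.obj X) :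
    ∃ P : π₀Obj X, x ∈ Set.range (F.map P.1.arrow) := by
  obtain ⟨Y, i, y, hy, hY, hi⟩ := fiber_in_connected_component F X x
  haveI : IsConnected (Subobject.mk i : C) := isConnected_of_iso (Subobject.underlyingIso i).symm
  refine ⟨⟨Subobject.mk i, inferInstance⟩, F.map (Subobject.underlyingIso i).inv y, ?_⟩
  show F.map (Subobject.mk i).arrow (F.map (Subobject.underlyingIso i).inv y) = x
  rw [← FintypeCat.comp_apply, ← F.map_comp, Subobject.underlyingIso_arrow]
  exact hy

/-- … and that component is unique: two connected components whose fibre-images share a point are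
equal ([SGA1] V: `connected_component_unique` plus rigidity of maps out of a connected object).
[cite: MochizukiSemiAnbd2006, Def. 2.2(i) p.23] -/
theorem component_eq_of_mem_range {X : C} (P Q : π₀Obj X) {x : F.obj X}
    (hP : x ∈ Set.range (F.map P.1.arrow)) (hQ : x ∈ Set.range (F.map Q.1.arrow)) : P = Q := by
  haveI : IsConnected (P.1 : C) := P.2
  haveI : IsConnected (Q.1 : C) := Q.2
  obtain ⟨p, hp⟩ := hP
  obtain ⟨q, hq⟩ := hQ
  obtain ⟨f, hf⟩ := connected_component_unique F p q P.1.arrow Q.1.arrow (hp.trans hq.symm)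
  have hcomm : f.hom ≫ Q.1.arrow = P.1.arrow := by
    apply evaluation_injective_of_isConnected F (P.1 : C) X p
    show F.map (f.hom ≫ Q.1.arrow) p = F.map P.1.arrow p
    rw [F.map_comp, FintypeCat.comp_apply, hf, hq, hp]
  exact Subtype.ext (Subobject.eq_of_comm f hcomm)

/-- Hence: two connected components are equal iff their fibre-images are the same orbit; in
particular `P ↦ F(P)` is a bijection from `π₀Obj X` onto the set of `Aut F`-orbits of `F(X)`
(stated pointwise). [cite: MochizukiSemiAnbd2006, Def. 2.2(i) p.23] -/
theorem component_eq_iff_range_eq {X : C} (P Q : π₀Obj X) :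
    P = Q ↔ Set.range (F.map P.1.arrow) = Set.range (F.map Q.1.arrow) := by
  refine ⟨fun h => h ▸ rfl, fun h => ?_⟩
  haveI : IsConnected (P.1 : C) := P.2
  obtain ⟨p⟩ := nonempty_fiber_of_isConnected F (P.1 : C)
  exact component_eq_of_mem_range F P Q ⟨p, rfl⟩ (h ▸ ⟨p, rfl⟩)

end Literature.AnabelianGeometry.Anabelioids
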